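import Summits.QuantumFields.GaugeBoot.StrongCouplingSecondOrderSUN
import Summits.QuantumFields.GaugeBoot.StrongCouplingPlaquetteSUN
import HarnessLib

/-!
# Strong coupling from the loop equation: THE SECOND STRONG-COUPLING COEFFICIENT OF THE `SU(N)` PLAQUETTE VANISHES FOR `N ≥ 4` (gauge-boot, ADDENDUM 25 part F)

HONEST FRAMING (cell `pub-gaugeboot`, page 1 of every file): the venture produces certified bounds
on lattice expectations at stated coupling, gauge group, dimension and torus size; NOT a mass gap,
NOT a continuum limit, NOT a string tension; NOT Yang–Mills-summit-bearing (barriers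
`FixedCouplingUltralocality`, `PerturbativeInvisibility`).  Analytic STRONG-COUPLING bounds with crude explicit
constants, uniform in the volume; informative only for small `β_std`; no number of CERTIFIED.md is touched.

## Content (`SU(N)`, `N ≥ 4`, fundamental representation, `d ≥ 2`, every torus side `L ≥ 2`, every real coupling)

ADDENDUM 22 gave `⟨ū_P⟩ = β_std/(2N²) + O(β_std²)` for `N ≥ 3`, ADDENDUM 24 the second coefficient `β_std²/216` for
`SU(3)` (the baryon vertex `∫_{SU(3)}(tr U)³ dU = 1`).  For `N ≥ 4` the one-plaquette integrals `∫(tr U)^a(tr U†)^b dU`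
vanish unless `a ≡ b (mod N)`, so no `β²` term is expected — and the loop equations prove it: three Makeenko–Migdal
steps (plaquette equation; the level-2 identities for `E[(tr U_P)²]`, `E[tr U_P²]`, `E|tr U_P|²`; the level-3 rows of
`StrongCouplingTriplePlaquette` / `StrongCouplingCubicSUN` for the cubic moments, closed by the read-once bound and
`|tr| ≤ N`) give

* ★★★ `abs_wilsonExpectation_meanPlaquette_suN_third_le` — tree coupling `β` (`= β_std/N`):
  **`|⟨ū_P⟩_{β,L} − β/(2N)| ≤ N·d²(d−1)·|β|³`**;
* ★★★ `abs_plaquetteExpectation_suN_third_le` — the cell's form: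
  **`|plaquetteExpectation N D L β_std − β_std/(2N²)| ≤ D²(D−1)·|β_std|³/N²`** for EVERY `L ≥ 2`, EVERY real `β_std`
  (`SU(4)`, `D = 4`: `≤ 3|β_std|³`): the strong-coupling series of the `SU(N)` plaquette, `N ≥ 4`, has NO `β_std²` TERM,
  as a theorem with a volume-uniform remainder.  With ADDENDUM 24 (`SU(3)`: `+β_std²/216`; `SU(2)`: no `β²` term) the
  second coefficient is now a theorem for every `SU(N)`, `N ≥ 2`: `c₂(N) = δ_{N,3}/216`.

References: R. Balian, J.-M. Drouffe, C. Itzykson, Phys. Rev. D 11 (1975) 2104; J.-M. Drouffe, J.-B. Zuber, Phys. Rept.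
102 (1983) §3; M. Creutz, *Quarks, gluons and lattices* (1983) Ch. 8; Yu. Makeenko, *Methods of contemporary gauge
theory* (2002) Problem 12.7.  Everything is `[folklore]`.
-/

noncomputable section

open MeasureTheory Filter Topology NormedSpace
open scoped Matrix.Norms.Frobenius Matrix ComplexConjugate
open Literature.MathematicalPhysics.QuantumFieldTheory Literature.MathematicalPhysics.QuantumLattice
open Summit.QuantumFields.YangMills.Cruxes.CurvatureAmnesia.WardDefect.SchwingerDyson

namespace Summit.QuantumFields.GaugeBoot

namespace StrongCoupling

variable {d L N : ℕ} [NeZero L]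

omit [NeZero L] in
/-- `64N⁴ ≤ 74(N² − 1)²` for `N ≥ 4` (rounding of the deformed-plaquette bound). [folklore] -/
theorem poly_aux₅ (N : ℝ) (hN : 4 ≤ N) : 64 * N ^ 4 ≤ 74 * (N ^ 2 - 1) ^ 2 := by
  have h16 : 0 ≤ N ^ 2 - 16 := by nlinarith
  nlinarith [mul_nonneg (sq_nonneg N) h16]

omit [NeZero L] in
/-- The final rounding: `23N² + 13DN + 46D + 29 + 74(2D−3)(D−1) ≤ 2N²(N²−1)D²` for `N ≥ 4`, `D ≥ 2`. [folklore] -/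
theorem poly_aux₆ (N D : ℝ) (hN : 4 ≤ N) (hD : 2 ≤ D) :
    23 * N ^ 2 + 13 * D * N + 46 * D + 29 + 74 * (2 * D - 3) * (D - 1) ≤ 2 * N ^ 2 * (N ^ 2 - 1) * D ^ 2 := by
  have h16 : 0 ≤ N ^ 2 - 16 := by nlinarith
  have hD2 : 0 ≤ D - 2 := by linarith
  have hN0 : 0 ≤ N := by linarith
  have hD0 : 0 ≤ D := by linarith
  have hD4 : 0 ≤ D ^ 2 - 4 := by nlinarith
  nlinarith [mul_nonneg h16 (sq_nonneg D), mul_nonneg (sq_nonneg N) hD4, mul_nonneg (mul_nonneg h16 (sq_nonneg N)) (sq_nonneg D),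
    mul_nonneg hN0 hD0, mul_nonneg (mul_nonneg hN0 hD0) hD2, mul_nonneg hD0 hD2, mul_nonneg (sq_nonneg N) (mul_nonneg hD0 hD2)]

/-- ★★★ **THE `SU(N)` PLAQUETTE AT STRONG COUPLING THROUGH THIRD ORDER, `N ≥ 4`.**  For `d ≥ 2`, every torus side `L ≥ 2`
and EVERY real (tree) coupling `β` (`= β_std/N`):
`|⟨ū_P⟩_{β,L} − β/(2N)| ≤ N·d²(d−1)·|β|³` — no `β²` term.
Three loop-equation steps closed by `|tr| ≤ N`; uniform in the volume. [folklore] -/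
theorem abs_wilsonExpectation_meanPlaquette_suN_third_le (hN : 4 ≤ N) (hL : (1 : ZMod L) ≠ 0) (hd : 2 ≤ d) (β : ℝ) :
    |wilsonExpectation (fundamentalRep (Fin N)) β
        (meanPlaquette (d := d) (L := L) (G := Matrix.specialUnitaryGroup (Fin N) ℂ) (fundamentalRep (Fin N))) -
        β / (2 * N)| ≤ N * (d : ℝ) ^ 2 * ((d : ℝ) - 1) * |β| ^ 3 := by
  obtain ⟨μ, ν₀, hμν₀⟩ : ∃ μ ν₀ : Fin d, μ ≠ ν₀ := ⟨⟨0, by omega⟩, ⟨1, by omega⟩, by simp [Fin.ext_iff]⟩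
  have hN2 : 2 ≤ N := by omega
  have hN0 : N ≠ 0 := by omega
  have hN4 : (4 : ℝ) ≤ N := by exact_mod_cast hN
  have hNpos : (0 : ℝ) < N := by linarith
  have hN21 : (0 : ℝ) < (N : ℝ) ^ 2 - 1 := by nlinarith
  have hd2 : (2 : ℝ) ≤ d := by exact_mod_cast hd
  have hd1 : (1 : ℝ) ≤ (d : ℝ) - 1 := by linarith
  set x : Site d L := fun _ => 0 with hx
  haveI : IsProbabilityMeasure (wilsonMeasure (d := d) (L := L) (fundamentalRep (Fin N)) β) :=
    isProbabilityMeasure_wilsonMeasure (d := d) (L := L) _ (fundamentalLatticeRep N).continuous β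
  -- Step 1: the plaquette loop equation (`s = 1`), restated on the nose
  have hleq := Equipartition.loopEquation_plaqWord (d := d) (L := L) (fundamentalLatticeRep N) hL β x hμν₀ true 1
    fun i j => sdPair_specialUnitaryGroup N β x μ x _ _ (trace_unitDir_one i j)
  simp only [integral_plaqTerm_latticeRep (fundamentalLatticeRep N)] at hleq
  simp only [fundamentalLatticeRep_N, fundamentalLatticeRep_ρ] at hleq
  have hleq' : ((N : ℂ) - 1 / N) * (∫ U, (fundamentalRep (Fin N) (wordHolonomy U x (plaqWord μ ν₀ true))).trace
      ∂(wilsonMeasure (d := d) (L := L) (fundamentalRep (Fin N)) β)) +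
      (β / 2 : ℂ) * ∑ ν ∈ Finset.univ.erase μ, ∑ ε : Bool,
        ((∫ U, (fundamentalRep (Fin N) (wordHolonomy U x (plaqWord μ ν₀ true ++ plaqWord μ ν ε))).trace
            ∂(wilsonMeasure (d := d) (L := L) (fundamentalRep (Fin N)) β)) -
          (∫ U, (fundamentalRep (Fin N) (wordHolonomy U x (plaqWord μ ν₀ true ++ (plaqWord μ ν ε).reverse))).trace
            ∂(wilsonMeasure (d := d) (L := L) (fundamentalRep (Fin N)) β)) -
          1 / (N : ℂ) * ((∫ U, (fundamentalRep (Fin N) (wordHolonomy U x (plaqWord μ ν₀ true))).trace *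
              (fundamentalRep (Fin N) (wordHolonomy U x (plaqWord μ ν ε))).trace
                ∂(wilsonMeasure (d := d) (L := L) (fundamentalRep (Fin N)) β)) -
            ∫ U, (fundamentalRep (Fin N) (wordHolonomy U x (plaqWord μ ν₀ true))).trace *
              (fundamentalRep (Fin N) (wordHolonomy U x (plaqWord μ ν ε).reverse)).trace
                ∂(wilsonMeasure (d := d) (L := L) (fundamentalRep (Fin N)) β))) = 0 := hleq
  have htriv : ∫ U, (fundamentalRep (Fin N)
      (wordHolonomy U x (plaqWord μ ν₀ true ++ (plaqWord μ ν₀ true).reverse))).trace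
        ∂(wilsonMeasure (d := d) (L := L) (fundamentalRep (Fin N)) β) = (N : ℂ) := by
    simp_rw [trace_plaqWord_append_reverse_suN]
    rw [integral_const, probReal_univ, one_smul]
  -- Step 2: the pieces, all `O(β²)`
  obtain ⟨ha, hb⟩ := secondMoments_suN_le₂ (d := d) (L := L) hN hL β x hμν₀
  have hc := norm_integral_trace_mul_trace_reverse_sub_one_suN_le₂ (d := d) (L := L) hN hL β x hμν₀
  have hν₀A : ν₀ ∈ Finset.univ.erase μ := Finset.mem_erase.2 ⟨fun h => hμν₀ h.symm, Finset.mem_univ _⟩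
  have hNinv : ‖(1 / (N : ℂ))‖ = 1 / N := by rw [norm_div, norm_one, Complex.norm_natCast]
  have hmain := norm_sub_le_of_loopEquation (d := d) hν₀A
    (fun ν ε => (∫ U, (fundamentalRep (Fin N) (wordHolonomy U x (plaqWord μ ν₀ true ++ plaqWord μ ν ε))).trace
        ∂(wilsonMeasure (d := d) (L := L) (fundamentalRep (Fin N)) β)) -
      (∫ U, (fundamentalRep (Fin N) (wordHolonomy U x (plaqWord μ ν₀ true ++ (plaqWord μ ν ε).reverse))).trace
        ∂(wilsonMeasure (d := d) (L := L) (fundamentalRep (Fin N)) β)) -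
      1 / (N : ℂ) * ((∫ U, (fundamentalRep (Fin N) (wordHolonomy U x (plaqWord μ ν₀ true))).trace *
          (fundamentalRep (Fin N) (wordHolonomy U x (plaqWord μ ν ε))).trace
            ∂(wilsonMeasure (d := d) (L := L) (fundamentalRep (Fin N)) β)) -
        ∫ U, (fundamentalRep (Fin N) (wordHolonomy U x (plaqWord μ ν₀ true))).trace *
          (fundamentalRep (Fin N) (wordHolonomy U x (plaqWord μ ν ε).reverse)).trace
            ∂(wilsonMeasure (d := d) (L := L) (fundamentalRep (Fin N)) β)))
    (b := (∫ U, (fundamentalRep (Fin N) (wordHolonomy U x (plaqWord μ ν₀ true ++ plaqWord μ ν₀ true))).trace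
        ∂(wilsonMeasure (d := d) (L := L) (fundamentalRep (Fin N)) β)) -
      1 / (N : ℂ) * (∫ U, (fundamentalRep (Fin N) (wordHolonomy U x (plaqWord μ ν₀ true))).trace *
        (fundamentalRep (Fin N) (wordHolonomy U x (plaqWord μ ν₀ true))).trace
          ∂(wilsonMeasure (d := d) (L := L) (fundamentalRep (Fin N)) β)) +
      1 / (N : ℂ) * ((∫ U, (fundamentalRep (Fin N) (wordHolonomy U x (plaqWord μ ν₀ true))).trace *
        (fundamentalRep (Fin N) (wordHolonomy U x (plaqWord μ ν₀ true).reverse)).trace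
          ∂(wilsonMeasure (d := d) (L := L) (fundamentalRep (Fin N)) β)) - 1))
    (B := 64 * ((d : ℝ) - 1) ^ 2 * (N : ℝ) ^ 3 * β ^ 2 / ((N : ℝ) ^ 2 - 1) ^ 2)
    (Bb := (23 * (N : ℝ) + 13 * d) * ((d : ℝ) - 1) * β ^ 2 + 1 / N * ((28 * (d : ℝ) + 38) * ((d : ℝ) - 1) * β ^ 2) +
      1 / N * ((18 * (d : ℝ) - 9) * ((d : ℝ) - 1) * β ^ 2))
    hleq' (by simp only [htriv]; ring)
    (by
      refine (norm_add_le _ _).trans (add_le_add ((norm_sub_le _ _).trans (add_le_add hb ?_)) ?_)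
      · rw [norm_mul, hNinv]; exact mul_le_mul_of_nonneg_left ha (by positivity)
      · rw [norm_mul, hNinv]; exact mul_le_mul_of_nonneg_left hc (by positivity))
    (fun ν hν => by
      obtain ⟨hνν₀, hν'⟩ := Finset.mem_erase.1 hν
      exact norm_plaqTermIntegral_le₂ (d := d) (L := L) hN2 hL β x hμν₀ (Finset.mem_erase.1 hν').1 (ε := true)
        (fun h' => hνν₀ h'.1))
    (fun ν hν => norm_plaqTermIntegral_le₂ (d := d) (L := L) hN2 hL β x hμν₀ (Finset.mem_erase.1 hν).1 (ε := false)
        (fun h' => Bool.false_ne_true h'.2))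
  rw [card_univ_erase_real] at hmain
  -- Step 3: real parts
  have hre := Equipartition.integral_re_trace_plaqWord (d := d) (L := L) (fundamentalLatticeRep N) β x hμν₀ true
    (by rw [fundamentalLatticeRep_N]; exact hN0)
  have hre0 := Equipartition.re_integral_eq (fundamentalLatticeRep N) β
    (continuous_trace_wordHolonomy (fundamentalLatticeRep N) x (plaqWord μ ν₀ true))
  simp only [fundamentalLatticeRep_N, fundamentalLatticeRep_ρ] at hre hre0
  rw [← hre0] at hre
  have hEP : (∫ U, (fundamentalRep (Fin N) (wordHolonomy U x (plaqWord μ ν₀ true))).trace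
      ∂(wilsonMeasure (d := d) (L := L) (fundamentalRep (Fin N)) β)).re =
      N * wilsonExpectation (fundamentalRep (Fin N)) β
        (meanPlaquette (d := d) (L := L) (G := Matrix.specialUnitaryGroup (Fin N) ℂ) (fundamentalRep (Fin N))) := hre
  have hreal : (((N : ℂ) - 1 / N) * (∫ U, (fundamentalRep (Fin N) (wordHolonomy U x (plaqWord μ ν₀ true))).trace
      ∂(wilsonMeasure (d := d) (L := L) (fundamentalRep (Fin N)) β)) - (β / 2 : ℂ) * ((N : ℂ) - 1 / N)).re =
      ((N : ℝ) ^ 2 - 1) * (wilsonExpectation (fundamentalRep (Fin N)) β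
        (meanPlaquette (d := d) (L := L) (G := Matrix.specialUnitaryGroup (Fin N) ℂ) (fundamentalRep (Fin N))) -
          β / (2 * N)) := by
    have hcC : ((N : ℂ) - 1 / N) = ((((N : ℝ) ^ 2 - 1) / N : ℝ) : ℂ) := by
      have hN0' : (N : ℂ) ≠ 0 := by exact_mod_cast hNpos.ne'
      push_cast; field_simp
    rw [hcC, show (β / 2 : ℂ) = ((β / 2 : ℝ) : ℂ) by push_cast; ring]
    simp only [Complex.sub_re, Complex.mul_re, Complex.ofReal_re, Complex.ofReal_im, mul_zero, sub_zero, zero_mul, hEP]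
    field_simp
  have hkey := (Complex.abs_re_le_norm _).trans hmain
  rw [hreal, abs_mul, abs_of_pos hN21] at hkey
  -- Step 4: rounding
  set W := wilsonExpectation (fundamentalRep (Fin N)) β
    (meanPlaquette (d := d) (L := L) (G := Matrix.specialUnitaryGroup (Fin N) ℂ) (fundamentalRep (Fin N))) with hW
  have hY : 0 ≤ ((d : ℝ) - 1) * β ^ 2 := by positivity
  have hB : 64 * ((d : ℝ) - 1) ^ 2 * (N : ℝ) ^ 3 * β ^ 2 / ((N : ℝ) ^ 2 - 1) ^ 2 ≤ 74 * ((d : ℝ) - 1) / N * (((d : ℝ) - 1) * β ^ 2) := by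
    rw [div_le_iff₀ (by positivity), div_mul_eq_mul_div, div_mul_eq_mul_div, le_div_iff₀ hNpos]
    have h := poly_aux₅ (N : ℝ) hN4
    have h0 : 0 ≤ ((d : ℝ) - 1) * (((d : ℝ) - 1) * β ^ 2) := by positivity
    nlinarith [mul_le_mul_of_nonneg_left h h0]
  have h23 : 0 ≤ ((d : ℝ) - 1 - 1) + ((d : ℝ) - 1) := by linarith
  have hsum : (23 * (N : ℝ) + 13 * d) * ((d : ℝ) - 1) * β ^ 2 + 1 / N * ((28 * (d : ℝ) + 38) * ((d : ℝ) - 1) * β ^ 2) +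
      1 / N * ((18 * (d : ℝ) - 9) * ((d : ℝ) - 1) * β ^ 2) +
      (((d : ℝ) - 1 - 1) + ((d : ℝ) - 1)) * (64 * ((d : ℝ) - 1) ^ 2 * (N : ℝ) ^ 3 * β ^ 2 / ((N : ℝ) ^ 2 - 1) ^ 2) ≤
      (2 * N * ((N : ℝ) ^ 2 - 1) * (d : ℝ) ^ 2) * (((d : ℝ) - 1) * β ^ 2) := by
    have h1 := mul_le_mul_of_nonneg_left hB h23
    have hK := poly_aux₆ (N : ℝ) d hN4 hd2
    have hK' := mul_le_mul_of_nonneg_right hK (by positivity : 0 ≤ ((d : ℝ) - 1) * β ^ 2 / N)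
    have e1 : (23 * (N : ℝ) + 13 * d) * ((d : ℝ) - 1) * β ^ 2 + 1 / N * ((28 * (d : ℝ) + 38) * ((d : ℝ) - 1) * β ^ 2) +
        1 / N * ((18 * (d : ℝ) - 9) * ((d : ℝ) - 1) * β ^ 2) +
        (((d : ℝ) - 1 - 1) + ((d : ℝ) - 1)) * (74 * ((d : ℝ) - 1) / N * (((d : ℝ) - 1) * β ^ 2)) =
        (23 * (N : ℝ) ^ 2 + 13 * d * N + 46 * d + 29 + 74 * (2 * d - 3) * (d - 1)) * (((d : ℝ) - 1) * β ^ 2 / N) := by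
      field_simp; ring
    have e2 : 2 * (N : ℝ) ^ 2 * ((N : ℝ) ^ 2 - 1) * (d : ℝ) ^ 2 * (((d : ℝ) - 1) * β ^ 2 / N) =
        (2 * N * ((N : ℝ) ^ 2 - 1) * (d : ℝ) ^ 2) * (((d : ℝ) - 1) * β ^ 2) := by field_simp
    linarith [h1, hK', e1, e2]
  have hfin : ((N : ℝ) ^ 2 - 1) * |W - β / (2 * N)| ≤ ((N : ℝ) ^ 2 - 1) * (N * (d : ℝ) ^ 2 * ((d : ℝ) - 1) * |β| ^ 3) := by
    refine hkey.trans ((mul_le_mul_of_nonneg_left hsum (by positivity)).trans (le_of_eq ?_))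
    rw [show |β| ^ 3 = |β| * β ^ 2 by rw [pow_succ', sq_abs]]
    ring
  exact le_of_mul_le_mul_left hfin hN21

/-! ## The cell's form -/

/-- ★★★ **The cell's form, third order, `SU(N)`, `N ≥ 4`** (`D ≥ 2`, every `L ≥ 2`, every real `β_std`):
`|plaquetteExpectation N D L β_std − β_std/(2N²)| ≤ D²(D−1)·|β_std|³/N²` — the strong-coupling series of the `SU(N)`
plaquette has no `β_std²` term, with an explicit, volume-uniform remainder. [folklore] -/
theorem abs_plaquetteExpectation_suN_third_le {N D L : ℕ} [NeZero L] (hN : 4 ≤ N) (hL : 2 ≤ L) (hD : 2 ≤ D) (β : ℝ) :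
    |plaquetteExpectation N D L β - β / (2 * (N : ℝ) ^ 2)| ≤ (D : ℝ) ^ 2 * ((D : ℝ) - 1) * |β| ^ 3 / (N : ℝ) ^ 2 := by
  have hN4 : (4 : ℝ) ≤ N := by exact_mod_cast hN
  have hNpos : (0 : ℝ) < N := by linarith
  have h := abs_wilsonExpectation_meanPlaquette_suN_third_le (d := D) (L := L) hN (zmod_one_ne_zero hL) hD (β / N)
  unfold plaquetteExpectation
  have e1 : β / N / (2 * N) = β / (2 * (N : ℝ) ^ 2) := by field_simp
  rw [e1] at h
  refine h.trans (le_of_eq ?_)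
  rw [abs_div, abs_of_pos hNpos]
  field_simp

/-- `SU(4)`, `D = 4`: `|plaquetteExpectation 4 4 L β_std − β_std/32| ≤ 3·|β_std|³` for every `L ≥ 2` and every real
`β_std`. [folklore] -/
theorem abs_plaquetteExpectation_four_four_third_le {L : ℕ} [NeZero L] (hL : 2 ≤ L) (β : ℝ) :
    |plaquetteExpectation 4 4 L β - β / 32| ≤ 3 * |β| ^ 3 := by
  have h := abs_plaquetteExpectation_suN_third_le (N := 4) (D := 4) (L := L) le_rfl hL (by norm_num) β
  norm_num at h
  linarith

/-- `SU(4)`, `D = 3`: `|plaquetteExpectation 4 3 L β_std − β_std/32| ≤ 9·|β_std|³/8`. [folklore] -/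
theorem abs_plaquetteExpectation_four_three_third_le {L : ℕ} [NeZero L] (hL : 2 ≤ L) (β : ℝ) :
    |plaquetteExpectation 4 3 L β - β / 32| ≤ 9 * |β| ^ 3 / 8 := by
  have h := abs_plaquetteExpectation_suN_third_le (N := 4) (D := 3) (L := L) le_rfl hL (by norm_num) β
  norm_num at h
  linarith

end StrongCoupling

end Summit.QuantumFields.GaugeBoot

end
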